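import Summits.AtomisticToContinuum.Crystallization.Theorems.ChessboardParticlePlanesPeriodicWindowsStubWideGapSyndetic
import Summits.AtomisticToContinuum.Crystallization.Theorems.ChessboardParticlePlanesPeriodicWindowsGapSqueezeCompetitor2

/-!
# Crux `PeriodicWindows` (stmt-AtomisticToContinuum-3240), line `dense-laminar-hull` — stub
# `hc_badOffsetSyndetic` (uniform recurrence makes bad consecutive offsets syndetic; elementary)

For the general aligned layered set `Z = B '' {i • v₁(a) + j • v₂(a) + δ m + z m • e₃}` (`B` a
linear isometry of `ℝ³` preserving the third coordinate, horizontal offsets `δ`, strictly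
increasing heights `z` with consecutive gaps `≥ 3/4`) which is rooted-uniformly recurrent (for all
`R, ε > 0` some `G` such that within `G` of every point of `Z` there is `g ∈ Z` with `Z - g`
two-way `ε`-matched with `Z` on the ball `B(0, R)`), ONE consecutive offset
`θ(m₀) = δ (m₀+1) - δ m₀` which is `2η`-far from the two hollow classes
`{± barlowOffset a} + ℤ v₁ + ℤ v₂` forces consecutive offsets `η`-far from the hollow classes to
occur with bounded gaps in the layer INDEX.

* `hcb_norm_horiz_le` — a horizontal vector is no longer than itself plus a vertical one;
* `hcb_exists_layerPoint_near` — every layer `k` of `Z` has a point within `2a + |z k - c 2|` of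
  any `c ∈ ℝ³` (covering radius of the triangular lattice, `gsc_cover`);
* `hcb_gap_accumulate` — `(3/4)(k - m) ≤ z k - z m` for `m ≤ k`;
* `hcb_far_of_near` — if `θ - θ' + ν` (`ν ∈ ℤ v₁ + ℤ v₂`) has norm `≤ 2ε ≤ η` and `θ` is `2η`-far
  from the hollow classes, then `θ'` is `η`-far from them (the classes are `ℤ v₁ + ℤ v₂`-invariant);
* `hc_badOffsetSyndetic` — for a layer index `m` take `w ∈ Z` on layer `m` and the recurrence
  witness `g ∈ Z` (on layer `m₁`, `|z m₁ - z m| ≤ G`) for `R = 2a + |z m₀| + |z (m₀+1)|`,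
  `ε = min (η/2) (1/8)`; two fixed points `x₀, x₁ ∈ Z ∩ B(0, R)` on layers `m₀, m₀ + 1` are
  `ε`-matched by `p₀ - g, p₁ - g` with `p₀, p₁ ∈ Z` on layers `k₀ < k₁`; a layer strictly between
  would sit at a height strictly inside `(z m₁ + z m₀ + ε, z m₁ + z (m₀+1) - ε)`, and a point of it
  near the vertical through `g` would give a point of `(Z - g) ∩ B(0, R)` whose height is `ε`-far
  from all heights of `Z`, against the matching; so `k₁ = k₀ + 1`, and comparing
  `x₁ - x₀ = B(μ + θ(m₀) + t e₃)` with `p₁ - p₀ = B(λ + θ(k₀) + t' e₃)` (lattice vectors `μ, λ`)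
  gives `‖θ(m₀) - θ(k₀) + (μ - λ)‖ ≤ 2ε`, whence `θ(k₀)` is `η`-far from the hollow classes;
  `|k₀ - m| ≤ L` with `L` independent of `m` by the `3/4`-gaps, and shifting `m` by `L` makes the
  index offset land in `[0, 2L]`.

All elementary. [folklore]
-/

noncomputable section

namespace Summit.AtomisticToContinuum.Crystallization.Theorems.PeriodicWindowsDenseLaminarHull

open Literature.MathematicalPhysics.StatisticalMechanics Filter Metric
open scoped BigOperators

/-! ## Elementary geometry of the layer vectors -/

/-- A horizontal vector `h` (`h 2 = 0`) is no longer than `h + t • e₃` (`‖h + t e₃‖² = ‖h‖² + t²`).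
[folklore] -/
private theorem hcb_norm_horiz_le (h : EuclideanSpace ℝ (Fin 3)) (hh : h 2 = 0) (t : ℝ) :
    ‖h‖ ≤ ‖h + t • layerNormal 1‖ := by
  have h1 : ‖h + t • layerNormal 1‖ ^ 2 = ‖h‖ ^ 2 + t ^ 2 := gsc_norm_sq_horiz_add h hh t
  nlinarith [norm_nonneg (h + t • layerNormal 1), norm_nonneg h, sq_nonneg t]

/-- `‖e₃‖ = 1` for `e₃ = layerNormal 1 = (0, 0, 1)`. [folklore] -/
private theorem hcb_norm_layerNormal_one : ‖(layerNormal 1 : EuclideanSpace ℝ (Fin 3))‖ = 1 := by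
  rw [EuclideanSpace.norm_eq]
  simp [layerNormal, Fin.sum_univ_three]

/-- **Every layer passes within `2a` of every point, horizontally.** For the layered set with frame
`B` (a linear isometry preserving heights), horizontal offsets `δ` and heights `z`, layer `k`
contains a point within `2a + |z k - c 2|` of any `c ∈ ℝ³`: decompose `B⁻¹ c = h + δ k + (c 2) e₃`
with `h` horizontal and approximate `h` in `ℤ v₁ + ℤ v₂` by `gsc_cover`. [folklore] -/
private theorem hcb_exists_layerPoint_near {a : ℝ} (ha : 0 < a)
    (B : EuclideanSpace ℝ (Fin 3) ≃ₗᵢ[ℝ] EuclideanSpace ℝ (Fin 3))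
    (δ : ℤ → EuclideanSpace ℝ (Fin 3)) (z : ℤ → ℝ)
    (hB : ∀ p : EuclideanSpace ℝ (Fin 3), (B p) 2 = p 2) (hδ : ∀ m : ℤ, (δ m) 2 = 0) (k : ℤ)
    (c : EuclideanSpace ℝ (Fin 3)) :
    ∃ i j : ℤ, dist (B (((i : ℝ) • triangularVec₁ a) + ((j : ℝ) • triangularVec₂ a) + δ k +
      (z k • layerNormal 1))) c ≤ 2 * a + |z k - c 2| := by
  have hc2 : (B.symm c) 2 = c 2 := by
    have h1 := hB (B.symm c)
    rw [LinearIsometryEquiv.apply_symm_apply] at h1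
    exact h1.symm
  have hn2 : (layerNormal 1 : EuclideanSpace ℝ (Fin 3)) 2 = 1 := by simp [layerNormal]
  obtain ⟨h, hh⟩ : ∃ h : EuclideanSpace ℝ (Fin 3), h = B.symm c - δ k - (c 2) • layerNormal 1 :=
    ⟨_, rfl⟩
  have hh2 : h 2 = 0 := by
    rw [hh, PiLp.sub_apply, PiLp.sub_apply, PiLp.smul_apply, hc2, hδ k, hn2, smul_eq_mul, mul_one,
      sub_zero, sub_self]
  obtain ⟨i, j, hij⟩ := gsc_cover ha h hh2
  refine ⟨i, j, ?_⟩
  have hP : ((i : ℝ) • triangularVec₁ a) + ((j : ℝ) • triangularVec₂ a) + δ k +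
      (z k • layerNormal 1) - B.symm c =
      -(h - ((i : ℝ) • triangularVec₁ a + (j : ℝ) • triangularVec₂ a)) +
        (z k - c 2) • layerNormal 1 := by
    rw [hh]
    module
  calc dist (B (((i : ℝ) • triangularVec₁ a) + ((j : ℝ) • triangularVec₂ a) + δ k +
        (z k • layerNormal 1))) c
      = dist (B (((i : ℝ) • triangularVec₁ a) + ((j : ℝ) • triangularVec₂ a) + δ k +
          (z k • layerNormal 1))) (B (B.symm c)) := by rw [LinearIsometryEquiv.apply_symm_apply]
    _ = ‖((i : ℝ) • triangularVec₁ a) + ((j : ℝ) • triangularVec₂ a) + δ k +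
          (z k • layerNormal 1) - B.symm c‖ := by
        rw [LinearIsometryEquiv.dist_map, dist_eq_norm]
    _ = ‖-(h - ((i : ℝ) • triangularVec₁ a + (j : ℝ) • triangularVec₂ a)) +
          (z k - c 2) • layerNormal 1‖ := by rw [hP]
    _ ≤ ‖-(h - ((i : ℝ) • triangularVec₁ a + (j : ℝ) • triangularVec₂ a))‖ +
          ‖(z k - c 2) • (layerNormal 1 : EuclideanSpace ℝ (Fin 3))‖ := norm_add_le _ _
    _ = ‖h - ((i : ℝ) • triangularVec₁ a + (j : ℝ) • triangularVec₂ a)‖ + |z k - c 2| := by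
        rw [norm_neg, norm_smul, Real.norm_eq_abs, hcb_norm_layerNormal_one, mul_one]
    _ ≤ 2 * a + |z k - c 2| := by gcongr

/-! ## Heights with gaps `≥ 3/4` -/

/-- Gaps `≥ 3/4` accumulate: `(3/4) n ≤ z (m + n) - z m`. [folklore] -/
private theorem hcb_gap_accumulate {z : ℤ → ℝ} (hgap : ∀ m : ℤ, (3 : ℝ) / 4 ≤ z (m + 1) - z m)
    (m : ℤ) (n : ℕ) : (3 : ℝ) / 4 * n ≤ z (m + n) - z m := by
  induction n with
  | zero => simp
  | succ n ih =>
    have h1 := hgap (m + n)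
    rw [add_assoc] at h1
    push_cast
    linarith

/-- Gaps `≥ 3/4` accumulate: `(3/4)(k - m) ≤ z k - z m` for `m ≤ k`. [folklore] -/
private theorem hcb_gap_accumulate' {z : ℤ → ℝ} (hgap : ∀ m : ℤ, (3 : ℝ) / 4 ≤ z (m + 1) - z m)
    {m k : ℤ} (hmk : m ≤ k) : (3 : ℝ) / 4 * ((k : ℝ) - m) ≤ z k - z m := by
  obtain ⟨n, rfl⟩ := Int.le.dest hmk
  have h1 := hcb_gap_accumulate hgap m n
  push_cast
  linarith

/-! ## Transfer of the distance to the hollow classes -/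

/-- **Horizontal comparison through the frame.** If `(u₁ - u₀) - (q₁ - q₀) = h + t • e₃` with `h`
horizontal, then `‖h‖ ≤ ‖(B u₁ - B u₀) - (B q₁ - B q₀)‖` for a linear isometry `B`. [folklore] -/
private theorem hcb_horiz_transfer (B : EuclideanSpace ℝ (Fin 3) ≃ₗᵢ[ℝ] EuclideanSpace ℝ (Fin 3))
    (u₀ u₁ q₀ q₁ h : EuclideanSpace ℝ (Fin 3)) (t : ℝ) (hh : h 2 = 0)
    (he : (u₁ - u₀) - (q₁ - q₀) = h + t • layerNormal 1) :
    ‖h‖ ≤ ‖(B u₁ - B u₀) - (B q₁ - B q₀)‖ := by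
  rw [← map_sub, ← map_sub, ← map_sub, LinearIsometryEquiv.norm_map, he]
  exact hcb_norm_horiz_le h hh t

/-- **The hollow classes are lattice invariant.** If `h = I v₁ + J v₂ + (θ - θ')` (`I, J ∈ ℤ`) has
norm `≤ 2ε`, `ε ≤ η/2`, and `θ` is `2η`-far from every `s b + i v₁ + j v₂` (`s = ±1`), then `θ'`
is `η`-far from every such point: `θ' - (s b + i v₁ + j v₂) = (θ - (s b + (i-I) v₁ + (j-J) v₂)) - h`.
[folklore] -/
private theorem hcb_far_of_near {a η ε : ℝ} (hεη : ε ≤ η / 2)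
    {θ θ' h : EuclideanSpace ℝ (Fin 3)} {I J : ℤ}
    (hh : h = (I : ℝ) • triangularVec₁ a + (J : ℝ) • triangularVec₂ a + (θ - θ'))
    (hnorm : ‖h‖ ≤ 2 * ε)
    (hfar : ∀ s i j : ℤ, s = 1 ∨ s = -1 →
      2 * η ≤ ‖θ - ((s : ℝ) • barlowOffset a + (i : ℝ) • triangularVec₁ a +
        (j : ℝ) • triangularVec₂ a)‖) :
    ∀ s i j : ℤ, s = 1 ∨ s = -1 →
      η ≤ ‖θ' - ((s : ℝ) • barlowOffset a + (i : ℝ) • triangularVec₁ a +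
        (j : ℝ) • triangularVec₂ a)‖ := by
  intro s i j hs
  have h1 := hfar s (i - I) (j - J) hs
  have h2 := norm_sub_norm_le (θ - ((s : ℝ) • barlowOffset a + ((i - I : ℤ) : ℝ) • triangularVec₁ a +
    ((j - J : ℤ) : ℝ) • triangularVec₂ a)) h
  have e : θ - ((s : ℝ) • barlowOffset a + ((i - I : ℤ) : ℝ) • triangularVec₁ a +
      ((j - J : ℤ) : ℝ) • triangularVec₂ a) - h =
      θ' - ((s : ℝ) • barlowOffset a + (i : ℝ) • triangularVec₁ a + (j : ℝ) • triangularVec₂ a) := by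
    rw [hh]
    push_cast
    module
  rw [e] at h2
  linarith

/-! ## The stub -/

/-- **Uniform recurrence makes bad consecutive offsets syndetic (numerics-free, elementary).** Let
`Z = B '' {i • v₁(a) + j • v₂(a) + δ m + z m • e₃}` be a general layered set (`B` a linear
isometry preserving the third coordinate, horizontal offsets `δ`, strictly increasing heights `z`
with gaps `≥ 3/4`) which is uniformly recurrent in the rooted sense (for every `R, ε` some `G`
such that within `G` of every point of `Z` there is `g ∈ Z` with `Z - g` two-way `ε`-matched with
`Z` on `B(0, R)`). If ONE consecutive offset `δ (m₀+1) - δ m₀` is `2η`-far (`η > 0`) from every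
`s • barlowOffset a + i • v₁ + j • v₂` (`s = ±1`, `i j : ℤ`), then consecutive offsets `η`-far from
all these points occur with bounded index gaps: `∃ G, ∀ m, ∃ g ∈ [0, G], …`. Route: with
`ε = min (η/2) (1/8)`, `R = 2a + |z m₀| + |z (m₀+1)|`, fix `x₀, x₁ ∈ Z ∩ B(0, R)` on layers
`m₀, m₀ + 1` (`hcb_exists_layerPoint_near`); for a layer index `m` take `w ∈ Z` on layer `m` and
the recurrence witness `g ∈ Z` within `G(R, ε)` of it, on layer `m₁` (`|z m₁ - z m| ≤ G`); the
matching gives `p₀, p₁ ∈ Z` with `dist (pᵢ - g) xᵢ ≤ ε`, on layers `k₀, k₁` with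
`|z k₀ - z m₁ - z m₀| ≤ ε`, `|z k₁ - z m₁ - z (m₀+1)| ≤ ε`; no layer of `Z` has height strictly
inside `(z m₁ + z m₀ + ε, z m₁ + z (m₀+1) - ε)` (a point `r` of it within horizontal distance `2a`
of `g` would give `r - g ∈ (Z - g) ∩ B(0, R)` at height `ε`-far from all heights of `Z`, against
the matching), so `k₁ = k₀ + 1`; then `‖(x₁ - x₀) - (p₁ - p₀)‖ ≤ 2ε` and `B` being a linear
isometry give `‖θ(m₀) - θ(k₀) + ν‖ ≤ 2ε` for a lattice vector `ν` (`hcb_horiz_transfer`), whence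
`θ(k₀)` is `η`-far from the hollow classes (`hcb_far_of_near`); finally
`|k₀ - m| ≤ L = ⌈(4/3)(G + |z m₀| + 1)⌉₊ + 1` by the `3/4`-gaps, and applying this at `m + L` puts
the offset in `[0, 2L]`. [folklore] -/
theorem hc_badOffsetSyndetic : ∀ a : ℝ, 0 < a →
    ∀ (B : EuclideanSpace ℝ (Fin 3) ≃ₗᵢ[ℝ] EuclideanSpace ℝ (Fin 3)) (δ : ℤ → EuclideanSpace ℝ (Fin 3)) (z : ℤ → ℝ),
    (∀ p : EuclideanSpace ℝ (Fin 3), (B p) 2 = p 2) → (∀ m : ℤ, (δ m) 2 = 0) → StrictMono z →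
    (∀ m : ℤ, (3 : ℝ) / 4 ≤ z (m + 1) - z m) →
    ∀ Z : Set (EuclideanSpace ℝ (Fin 3)), Z = (fun p => B p) '' {p | ∃ m i j : ℤ, p = ((i : ℝ) • triangularVec₁ a) +
      ((j : ℝ) • triangularVec₂ a) + δ m + (z m • layerNormal 1)} →
    (∀ R ε : ℝ, 0 < ε → ∃ G : ℝ, ∀ w ∈ Z, ∃ g ∈ Z, dist g w ≤ G ∧
      BallMatch ε R 0 ((fun p => p - g) '' Z) Z) →
    ∀ η : ℝ, 0 < η → ∀ m₀ : ℤ,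
    (∀ s i j : ℤ, s = 1 ∨ s = -1 → 2 * η ≤ ‖(δ (m₀ + 1) - δ m₀) -
      ((s : ℝ) • barlowOffset a + (i : ℝ) • triangularVec₁ a + (j : ℝ) • triangularVec₂ a)‖) →
    ∃ G : ℕ, ∀ m : ℤ, ∃ g : ℤ, 0 ≤ g ∧ g ≤ G ∧
      ∀ s i j : ℤ, s = 1 ∨ s = -1 → η ≤ ‖(δ (m + g + 1) - δ (m + g)) -
        ((s : ℝ) • barlowOffset a + (i : ℝ) • triangularVec₁ a + (j : ℝ) • triangularVec₂ a)‖ := by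
  intro a ha B δ z hB hδ hz hgap Z hZ hrec η hη m₀ hm₀
  -- (F0) the parametrisation
  obtain ⟨P, hP⟩ : ∃ P : ℤ → ℤ → ℤ → EuclideanSpace ℝ (Fin 3), ∀ m i j : ℤ,
      P m i j = ((i : ℝ) • triangularVec₁ a) + ((j : ℝ) • triangularVec₂ a) + δ m +
        (z m • layerNormal 1) := ⟨fun m i j => _, fun _ _ _ => rfl⟩
  -- (F1) layer points: membership, parametrisation and heights
  have hmem : ∀ m i j : ℤ, B (P m i j) ∈ Z := fun m i j => by
    rw [hZ, hP]
    exact ⟨_, ⟨m, i, j, rfl⟩, rfl⟩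
  have hZpar : ∀ p ∈ Z, ∃ m i j : ℤ, p = B (P m i j) := by
    intro p hp
    rw [hZ] at hp
    obtain ⟨q, ⟨m, i, j, rfl⟩, rfl⟩ := hp
    exact ⟨m, i, j, by rw [hP]⟩
  have hpt2 : ∀ m i j : ℤ, (B (P m i j)) 2 = z m := fun m i j => by
    rw [hP]
    exact gsc_pt_two hB hδ m _ _ _
  have hZ2 : ∀ p ∈ Z, ∃ m : ℤ, p 2 = z m := by
    intro p hp
    obtain ⟨m, i, j, rfl⟩ := hZpar p hp
    exact ⟨m, hpt2 m i j⟩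
  -- coordinates are `1`-Lipschitz
  have hlip : ∀ p q : EuclideanSpace ℝ (Fin 3), |p 2 - q 2| ≤ dist p q := fun p q => by
    rw [← Real.dist_eq]
    exact PiLp.dist_apply_le p q 2
  -- (F2) covering: layer `k` has a point within `2a + |z k - c 2|` of any `c`
  have hcovP : ∀ (k : ℤ) (c : EuclideanSpace ℝ (Fin 3)),
      ∃ i j : ℤ, dist (B (P k i j)) c ≤ 2 * a + |z k - c 2| := by
    intro k c
    obtain ⟨i, j, hij⟩ := hcb_exists_layerPoint_near ha B δ z hB hδ k c
    exact ⟨i, j, by rw [hP]; exact hij⟩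
  have hcov : ∀ (k : ℤ) (c : EuclideanSpace ℝ (Fin 3)),
      ∃ r ∈ Z, r 2 = z k ∧ dist r c ≤ 2 * a + |z k - c 2| := by
    intro k c
    obtain ⟨i, j, hij⟩ := hcovP k c
    exact ⟨_, hmem k i j, hpt2 k i j, hij⟩
  -- growth of the heights
  have hgrow : ∀ m k : ℤ, m ≤ k → (3 : ℝ) / 4 * ((k : ℝ) - m) ≤ z k - z m :=
    fun m k hmk => hcb_gap_accumulate' hgap hmk
  -- the constants
  obtain ⟨ε, hε_def⟩ : ∃ ε : ℝ, ε = min (η / 2) (1 / 8) := ⟨_, rfl⟩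
  have hε : 0 < ε := by rw [hε_def]; exact lt_min (by linarith) (by norm_num)
  have hεη : ε ≤ η / 2 := hε_def ▸ min_le_left _ _
  have hε1 : ε ≤ 1 / 8 := hε_def ▸ min_le_right _ _
  obtain ⟨G, hG⟩ := hrec (2 * a + |z m₀| + |z (m₀ + 1)|) ε hε
  obtain ⟨X, hX⟩ : ∃ X : ℝ, X = G + |z m₀| + 1 := ⟨_, rfl⟩
  obtain ⟨L, hL_def⟩ : ∃ L : ℕ, L = ⌈(4 : ℝ) / 3 * X⌉₊ + 1 := ⟨_, rfl⟩
  have hL : (4 : ℝ) / 3 * X + 1 ≤ (L : ℝ) := by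
    rw [hL_def]
    push_cast
    linarith [Nat.le_ceil ((4 : ℝ) / 3 * X)]
  have h0 := abs_nonneg (z m₀)
  have h0' := abs_nonneg (z (m₀ + 1))
  have h0l := neg_abs_le (z m₀)
  have h0u := le_abs_self (z m₀)
  have h1l := neg_abs_le (z (m₀ + 1))
  have h1u := le_abs_self (z (m₀ + 1))
  have hg₀ := hgap m₀
  -- (F3) two reference points of `Z` in the ball `B(0, R)`, on layers `m₀` and `m₀ + 1`
  obtain ⟨i₀, j₀, hx₀⟩ := hcovP m₀ 0
  obtain ⟨i₁, j₁, hx₁⟩ := hcovP (m₀ + 1) 0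
  have hx₀R : dist (B (P m₀ i₀ j₀)) 0 ≤ 2 * a + |z m₀| + |z (m₀ + 1)| := by
    refine hx₀.trans ?_
    rw [PiLp.zero_apply, sub_zero]
    linarith
  have hx₁R : dist (B (P (m₀ + 1) i₁ j₁)) 0 ≤ 2 * a + |z m₀| + |z (m₀ + 1)| := by
    refine hx₁.trans ?_
    rw [PiLp.zero_apply, sub_zero]
    linarith
  -- the core claim: a bad offset within index distance `L` of every `m`
  have hcore : ∀ m : ℤ, ∃ k : ℤ, m - L ≤ k ∧ k ≤ m + L ∧
      ∀ s i j : ℤ, s = 1 ∨ s = -1 → η ≤ ‖(δ (k + 1) - δ k) -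
        ((s : ℝ) • barlowOffset a + (i : ℝ) • triangularVec₁ a + (j : ℝ) • triangularVec₂ a)‖ := by
    intro m
    -- (F4) the recurrence witness near layer `m`
    obtain ⟨w, hw, hw2⟩ : ∃ w ∈ Z, w 2 = z m := ⟨_, hmem m 0 0, hpt2 m 0 0⟩
    obtain ⟨g, hg, hgw, hmatch⟩ := hG w hw
    obtain ⟨m₁, hgm₁⟩ := hZ2 g hg
    have hm₁m : |z m₁ - z m| ≤ G := by
      rw [← hgm₁, ← hw2]
      exact (hlip g w).trans hgw
    obtain ⟨hGlb, hGub⟩ := abs_le.1 hm₁m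
    -- (F5) no layer strictly inside the shifted window
    have hF5 : ∀ k : ℤ, z m₁ + z m₀ + ε < z k → z m₁ + z (m₀ + 1) - ε ≤ z k := by
      intro k hk
      by_contra hlt
      rw [not_le] at hlt
      obtain ⟨r, hr, hr2, hrg⟩ := hcov k g
      have hq : r - g ∈ (fun p => p - g) '' Z := ⟨r, hr, rfl⟩
      have hq0 : dist (r - g) 0 ≤ 2 * a + |z m₀| + |z (m₀ + 1)| := by
        rw [dist_zero_right, ← dist_eq_norm]
        refine hrg.trans ?_
        rw [hgm₁]
        have : |z k - z m₁| ≤ |z m₀| + |z (m₀ + 1)| := by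
          rw [abs_le]
          constructor <;> linarith
        linarith
      obtain ⟨s, hs, hqs⟩ := hmatch.2 (r - g) hq hq0
      obtain ⟨k', hk'⟩ := hZ2 s hs
      have h1 := (hlip (r - g) s).trans hqs
      rw [PiLp.sub_apply, hr2, hgm₁, hk', abs_le] at h1
      have hlo : z m₀ < z k' := by linarith [h1.1, h1.2]
      have hhi : z k' < z (m₀ + 1) := by linarith [h1.1, h1.2]
      have := hz.lt_iff_lt.1 hlo
      have := hz.lt_iff_lt.1 hhi
      omega
    -- (F6) matching the two reference points
    obtain ⟨a₀, ⟨p₀, hp₀, rfl⟩, ha₀x⟩ := hmatch.1 _ (hmem m₀ i₀ j₀) hx₀R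
    obtain ⟨k₀, i₀', j₀', rfl⟩ := hZpar p₀ hp₀
    obtain ⟨a₁, ⟨p₁, hp₁, rfl⟩, ha₁x⟩ := hmatch.1 _ (hmem (m₀ + 1) i₁ j₁) hx₁R
    obtain ⟨k₁, i₁', j₁', rfl⟩ := hZpar p₁ hp₁
    dsimp only at ha₀x ha₁x
    -- heights of the matched layers
    have hh₀ : |z k₀ - z m₁ - z m₀| ≤ ε := by
      have h1 := (hlip _ _).trans ha₀x
      rwa [PiLp.sub_apply, hpt2, hgm₁, hpt2] at h1
    have hh₁ : |z k₁ - z m₁ - z (m₀ + 1)| ≤ ε := by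
      have h1 := (hlip _ _).trans ha₁x
      rwa [PiLp.sub_apply, hpt2, hgm₁, hpt2] at h1
    obtain ⟨hh₀l, hh₀u⟩ := abs_le.1 hh₀
    obtain ⟨hh₁l, hh₁u⟩ := abs_le.1 hh₁
    have hgk₀ := hgap k₀
    -- (F7) the matched layers are consecutive
    have hk1 : z m₁ + z (m₀ + 1) - ε ≤ z (k₀ + 1) := hF5 (k₀ + 1) (by linarith)
    have hk₁ : k₁ = k₀ + 1 := by
      have hlt1 : k₀ < k₁ := hz.lt_iff_lt.1 (by linarith)
      rcases lt_or_ge k₁ (k₀ + 2) with hlt2 | hle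
      · omega
      · exfalso
        have h2 := hgrow (k₀ + 1) k₁ (by omega)
        have h3 : (k₀ : ℝ) + 2 ≤ (k₁ : ℝ) := by exact_mod_cast hle
        push_cast at h2
        linarith
    subst hk₁
    -- (F8) the transfer of the offset
    have hdist : ‖(B (P (m₀ + 1) i₁ j₁) - B (P m₀ i₀ j₀)) -
        (B (P (k₀ + 1) i₁' j₁') - B (P k₀ i₀' j₀'))‖ ≤ 2 * ε := by
      have e : (B (P (m₀ + 1) i₁ j₁) - B (P m₀ i₀ j₀)) -
          (B (P (k₀ + 1) i₁' j₁') - B (P k₀ i₀' j₀')) =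
          (B (P (m₀ + 1) i₁ j₁) - (B (P (k₀ + 1) i₁' j₁') - g)) -
            (B (P m₀ i₀ j₀) - (B (P k₀ i₀' j₀') - g)) := by abel
      rw [e]
      calc ‖(B (P (m₀ + 1) i₁ j₁) - (B (P (k₀ + 1) i₁' j₁') - g)) -
            (B (P m₀ i₀ j₀) - (B (P k₀ i₀' j₀') - g))‖
          ≤ ‖B (P (m₀ + 1) i₁ j₁) - (B (P (k₀ + 1) i₁' j₁') - g)‖ +
            ‖B (P m₀ i₀ j₀) - (B (P k₀ i₀' j₀') - g)‖ := norm_sub_le _ _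
        _ ≤ ε + ε := add_le_add (by rw [← dist_eq_norm, dist_comm]; exact ha₁x)
            (by rw [← dist_eq_norm, dist_comm]; exact ha₀x)
        _ = 2 * ε := by ring
    obtain ⟨h, hh⟩ : ∃ h : EuclideanSpace ℝ (Fin 3),
        h = ((i₁ - i₀ - i₁' + i₀' : ℤ) : ℝ) • triangularVec₁ a +
          ((j₁ - j₀ - j₁' + j₀' : ℤ) : ℝ) • triangularVec₂ a +
          ((δ (m₀ + 1) - δ m₀) - (δ (k₀ + 1) - δ k₀)) := ⟨_, rfl⟩
    have hh2 : h 2 = 0 := by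
      simp [hh, hδ, gsc_triangularVec₁_two, gsc_triangularVec₂_two]
    have he : (P (m₀ + 1) i₁ j₁ - P m₀ i₀ j₀) - (P (k₀ + 1) i₁' j₁' - P k₀ i₀' j₀') =
        h + ((z (m₀ + 1) - z m₀) - (z (k₀ + 1) - z k₀)) • layerNormal 1 := by
      rw [hh]
      simp only [hP]
      push_cast
      module
    have hnorm : ‖h‖ ≤ 2 * ε := (hcb_horiz_transfer B _ _ _ _ h _ hh2 he).trans hdist
    have hfar := hcb_far_of_near hεη hh hnorm hm₀
    -- (F9) index bounds
    refine ⟨k₀, ?_, ?_, hfar⟩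
    · by_contra hlt
      rw [not_le] at hlt
      have h1 := hgrow k₀ m (by omega)
      have h2 : (L : ℝ) ≤ (m : ℝ) - k₀ := by
        have : (L : ℤ) ≤ m - k₀ := by omega
        exact_mod_cast this
      linarith
    · by_contra hlt
      rw [not_le] at hlt
      have h1 := hgrow m k₀ (by omega)
      have h2 : (L : ℝ) ≤ (k₀ : ℝ) - m := by
        have : (L : ℤ) ≤ k₀ - m := by omega
        exact_mod_cast this
      linarith
  -- conclusion: apply the core claim at `m + L`
  refine ⟨2 * L, fun m => ?_⟩
  obtain ⟨k, hk1, hk2, hk⟩ := hcore (m + L)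
  refine ⟨k - m, by omega, by push_cast; omega, ?_⟩
  have e : m + (k - m) = k := by omega
  rw [e]
  exact hk

end Summit.AtomisticToContinuum.Crystallization.Theorems.PeriodicWindowsDenseLaminarHull

end
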